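import Literature.AnabelianGeometry.SemiGraphs.TemperedDecompositionCommTerminal
import HarnessLib

/-!
# Decomposition homomorphisms `Π^tp_ℍ → Π^tp_𝔾` are closed embeddings — modulo pointed domination of
# tempered coverings ([IUTchI] §2 p. 44; [SemiAnbd] Prop. 2.5 (i), Prop. 3.6)

Mochizuki, *Inter-universal Teichmüller theory I*, §2 p. 44 l. 39–44: for a connected sub-semi-graph
`ℍ ⊆ 𝔾` "we thus obtain a natural commutative diagram `Π^tp_ℋ → Π̂_ℋ / Π^tp_𝒢 → Π̂_𝒢` of [outer]
inclusions [cf. [SemiAnbd], Proposition 2.5, (i), when `Σ̂ = 𝔓𝔯𝔦𝔪𝔢𝔰`; … a similar proof may be given in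
the case of arbitrary `Σ̂` …] of topological groups" [cite: Mochizuki2012, IUTchI §2 p.44]
[claim: Mochizuki2012, status: disputed]; Mochizuki, *Semi-graphs of anabelioids*, Publ. RIMS **42**
(2006), Prop. 2.5 (i) p. 27 (injectivity of `Π_ℍ → Π_𝒢`, proved by the finite-étale covering-extension
argument "any finite étale Galois covering of `𝒢_ℍ` may be split by a finite étale covering pulled back
from `𝒢`") and §3 pp. 33–38 (tempered groups, `B^temp`, charts) [cite: MochizukiSemiAnbd2006, Prop 2.5(i) p.27].

PROOF-ONLY file (abc-iut cell, layer L3, row «DECOMP-EMB», part (B) TRANSLATION, of GAP-LEDGER row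
G-w4d052-g5-1; seat abc-iut-w4-d052 gen 5; part (C) — the domination property (DOM) itself — is
abc-iut-L3-d1's).  It turns the embedding hypothesis `hind : IsInducing φ` of
`TemperedDecompositionCommTerminal.lean` (for a decomposition homomorphism `φ : π₁^temp(𝒢_ℍ) → π₁^temp(𝒢)`,
`TemperedPiChart.IsDecompHom`, of abc-iut's `TemperedDecompositionSubgroups.lean`) into a CHART-FREE,
`Prop`-free statement about tempered coverings, displayed verbatim as the hypothesis `hdom`:

  (DOM)  for every tempered covering `T` of `𝒢_ℍ`, every vertex `v` of `ℍ` and every point `t` of the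
  fibre `T_v`, there are a tempered covering `S` of `𝒢`, a tempered covering `C` of `𝒢_ℍ` with a
  morphism `ι : C → S|_ℍ` injective on the `v`-fibre (typically a connected component of `S|_ℍ`,
  `CovObj.restrictι`) and a morphism `f : C → T` with `t` in the image of `f_v`
  — "every pointed tempered covering of `𝒢_ℍ` is dominated by a sub-covering of the restriction of a
  tempered covering of `𝒢`".

* `IsTempered.isInducing_of_forall_openNormalSubgroup` — (COF) ⇒ (EMB) for tempered groups: if every
  open normal subgroup of `Π′` contains some `φ⁻¹(U)`, `U ∋ 1` open, then `φ` induces the topology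
  (`IsTempered.basis` + Mathlib `IsTopologicalGroup.isInducing_iff_nhds_one`);
* **`IsDecompHom.isInducing_of_dom`** — (DOM) ⇒ `IsInducing φ`.  Dictionary: along a verticial
  homomorphism `ψ : Π_v → π₁^temp(𝒢_ℍ)` at a vertex `v ∈ ℍ` (Thm. 3.7 (i), `verticialInjective_holds`) the
  fibre `X_v` of any `X ∈ B^temp(𝒢_ℍ)` IS the underlying set of `c′(X)`, naturally and equivariantly
  (`Jnat : (X ↦ X_v) ≅ c′ ⋙ B^temp(ψ)`); `c′(S|_ℍ) ≅ B^temp(φ)(c S)` (the decomposition isomorphism at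
  `c S`); for an open normal `N′ ⊆ Π′ := π₁^temp(𝒢_ℍ)` take `T := c′⁻¹(Π′/N′)` (`BTemp.quotientObj`),
  dominate its base point by `(S, C, ι, f, s)`; the point `s` read in `c(S)` has OPEN stabiliser `U`, and
  `φ⁻¹(U) = Stab_{Π′}(s in c′(C))` (fibre-injectivity of `ι`) `⊆ Stab_{Π′}(f(s) in Π′/N′) = N′`;
* `IsDecompHom.isClosedEmbedding_of_dom` — hence `φ` is a CLOSED EMBEDDING (engines
  `IsTempered.injective_of_isInducing` / `isClosed_range_of_isInducing` of the (P2) file);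
* `decompSubgroupsCommensurablyTerminal_of_dom` (+ `_of_finite`) — **[IUTchI] Prop. 2.2 third inclusion
  modulo (DOM)**; `isClosed_of_mem_decompSubgroups_of_dom` — every decomposition subgroup is closed (the
  tempered input `hDcl` of the profinite (P1) file of abc-iut-w5-d240).

HONEST SCOPE: (DOM) is NOT proved here (row «DECOMP-EMB» part (C): finite half = [SemiAnbd] Prop. 2.5 (i)
— in the tree on the `SemiGraphOfAnabelioids` side as `piHToPi_injective` — plus the graph-covering /
universal-covering extension); it is an explicit hypothesis binder, not a named fact.  Theorems only, no
`def`, no instance, no notation; nothing here takes a side on [IUTchIII] Cor. 3.12.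
-/

namespace Literature.AnabelianGeometry.SemiGraphs

open CategoryTheory Topology Filter
open scoped Pointwise

universe u

/-! ### (COF) ⇒ embedding, for tempered groups -/

section COF

variable {Γ Γ' : Type*} [Group Γ] [TopologicalSpace Γ] [IsTopologicalGroup Γ]
  [Group Γ'] [TopologicalSpace Γ'] [IsTopologicalGroup Γ']

/-- **(COF) ⇒ (EMB) for tempered groups.**  If every open normal subgroup of the TEMPERED group `Γ′`
contains the preimage `φ⁻¹(U)` of an open neighbourhood `U ∋ 1` of `Γ`, then the continuous homomorphism
`φ : Γ′ → Γ` induces the topology of `Γ′` (open normal subgroups form a basis of neighbourhoods of `1` in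
a tempered group, `IsTempered.basis`; Mathlib `IsTopologicalGroup.isInducing_iff_nhds_one`).
[cite: MochizukiSemiAnbd2006, Def 3.1(i) p.33] -/
theorem IsTempered.isInducing_of_forall_openNormalSubgroup (hΓ' : IsTempered Γ') (φ : Γ' →ₜ* Γ)
    (h : ∀ N' : OpenNormalSubgroup Γ', ∃ U : Set Γ, IsOpen U ∧ (1 : Γ) ∈ U ∧ φ ⁻¹' U ⊆ N') :
    IsInducing φ := by
  rw [IsTopologicalGroup.isInducing_iff_nhds_one]
  refine le_antisymm ?_ fun s hs => ?_
  · have h1 : Filter.Tendsto (⇑φ) (𝓝 1) (𝓝 (φ 1)) := (map_continuous φ).tendsto (1 : Γ')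
    rw [map_one] at h1
    exact Filter.tendsto_iff_comap.mp h1
  · obtain ⟨N', -, hN's⟩ := hΓ'.basis s hs
    obtain ⟨U, hUo, h1U, hUN⟩ := h N'
    exact Filter.mem_of_superset (Filter.preimage_mem_comap (hUo.mem_nhds h1U)) (hUN.trans hN's)

end COF

namespace ProfiniteSemiGraph

namespace TemperedPiChart

variable {𝒢 : ProfiniteSemiGraph.{u}} {c : TemperedPiChart 𝒢} {H : 𝒢.graph.Subgraph}

/-- Points of `Π ⧸ N` fixed by `g` force `g ∈ N` (`N` normal). [folklore] -/
private theorem mem_of_smul_quotient_eq {Γ : Type*} [Group Γ] (N : Subgroup Γ) [N.Normal] (g : Γ)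
    (q : Γ ⧸ N) (hq : g • q = q) : g ∈ N := by
  induction q using QuotientGroup.induction_on with
  | H y =>
    rw [MulAction.Quotient.smul_mk, QuotientGroup.eq] at hq
    have : y * ((g * y)⁻¹ * y) * y⁻¹ ∈ N := Subgroup.Normal.conj_mem inferInstance _ hq y
    have hg : g⁻¹ ∈ N := by simpa [mul_assoc] using this
    simpa using N.inv_mem hg

/-- The underlying map of an isomorphism of `B^temp(Π)` is injective. [folklore] -/
private theorem BTemp.iso_injective {G : Type u} [Group G] [TopologicalSpace G] {A B : BTemp G}
    (i : A ≅ B) : Function.Injective (i.hom.hom.hom : A.obj.V → B.obj.V) :=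
  (((temperedAction G).ι ⋙ Action.forget (Type u) G).mapIso i).toEquiv.injective

/-- The underlying map of an isomorphism of `B^temp(Π)` is surjective. [folklore] -/
private theorem BTemp.iso_surjective {G : Type u} [Group G] [TopologicalSpace G] {A B : BTemp G}
    (i : A ≅ B) : Function.Surjective (i.hom.hom.hom : A.obj.V → B.obj.V) :=
  (((temperedAction G).ι ⋙ Action.forget (Type u) G).mapIso i).toEquiv.surjective

/-- **(B) TRANSLATION — pointed domination (DOM) of the tempered coverings of `𝒢_ℍ` by sub-coverings of
restrictions of tempered coverings of `𝒢` ⇒ the decomposition homomorphism `φ : π₁^temp(𝒢_ℍ) → π₁^temp(𝒢)`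
INDUCES the topology of `π₁^temp(𝒢_ℍ)`** (print: "inclusions … of topological groups", [IUTchI] §2 p. 44;
the content of (DOM) is [SemiAnbd] Prop. 2.5 (i)'s covering-extension argument lifted to tempered
coverings).  Needs only Thm. 3.7's hypotheses for `𝒢_ℍ` (for one verticial homomorphism of its chart,
`verticialInjective_holds`).  See the module docstring for the dictionary.
[cite: Mochizuki2012, IUTchI §2 p.44] -/
theorem IsDecompHom.isInducing_of_dom (h37H : (𝒢.restrict H).Thm37Hypotheses)
    {c' : TemperedPiChart (𝒢.restrict H)} {φ : c'.G →ₜ* c.G} (hφ : c.IsDecompHom H c' φ)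
    (hdom : ∀ (T : BTempCat (𝒢.restrict H)) (v : H.toSemiGraph.Vertex) (t : (T.obj.SV v).obj.V),
      ∃ (S : BTempCat 𝒢) (C : BTempCat (𝒢.restrict H)) (ι : C ⟶ (𝒢.btempRestrict H).obj S)
        (f : C ⟶ T) (s : (C.obj.SV v).obj.V),
        Function.Injective (ι.hom.fV v).hom.hom ∧ (f.hom.fV v).hom.hom s = t) :
    IsInducing φ := by
  classical
  haveI := c.isTopologicalGroup
  haveI := c'.isTopologicalGroup
  -- a vertex `v` of `ℍ` with a verticial homomorphism `ψ : Π_v → π₁^temp(𝒢_ℍ)` (Thm 3.7 (i) for `𝒢_ℍ`)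
  obtain ⟨v⟩ := h37H.hasVertex
  obtain ⟨-, ψ, ⟨k⟩, -⟩ := (verticialInjective_holds (𝒢.restrict H) h37H c' v).1
  obtain ⟨e⟩ := hφ
  -- the dictionary `X_v ≅ B^temp(ψ)(c′ X)`, natural in `X ∈ B^temp(𝒢_ℍ)`
  let Jnat : ObjectProperty.ι _ ⋙ restrictV (𝒢.restrict H) v ≅ c'.equiv.functor ⋙ BTemp.res ψ :=
    (Functor.leftUnitor _).symm ≪≫
      Functor.isoWhiskerRight c'.equiv.unitIso (ObjectProperty.ι _ ⋙ restrictV (𝒢.restrict H) v) ≪≫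
      Functor.isoWhiskerLeft c'.equiv.functor k
  refine c'.isTempered.isInducing_of_forall_openNormalSubgroup φ fun N' => ?_
  -- the Galois object `Π′/N′` and the tempered covering `T` of `𝒢_ℍ` it corresponds to
  let Q : BTemp c'.G := BTemp.quotientObj c'.G c'.isTempered N'.toSubgroup N'.isOpen'
  let T : BTempCat (𝒢.restrict H) := c'.equiv.inverse.obj Q
  -- a point of `T_v`: the base coset read through `k`
  let q₀ : Q.obj.V := ((1 : c'.G) : c'.G ⧸ N'.toSubgroup)
  let t : (T.obj.SV v).obj.V := (k.inv.app Q).hom.hom q₀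
  obtain ⟨S, C, ι, f, s, hι, -⟩ := hdom T v t
  -- `c′(S|_ℍ) ≅ B^temp(φ)(c S)` (the decomposition isomorphism at `c S`, moved along the unit)
  let SH : BTempCat (𝒢.restrict H) := (𝒢.btempRestrict H).obj S
  let XS : BTemp c.G := c.equiv.functor.obj S
  let E : c'.equiv.functor.obj SH ≅ (BTemp.res φ).obj XS :=
    (𝒢.btempRestrict H ⋙ c'.equiv.functor).mapIso (c.equiv.unitIso.app S) ≪≫ e.app XS
  -- the point `s` upstairs, its image `w` in `c′(S|_ℍ)` and `x` in `c(S)`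
  let z : (c'.equiv.functor.obj C).obj.V := (Jnat.hom.app C).hom.hom s
  let w : (c'.equiv.functor.obj SH).obj.V := (c'.equiv.functor.map ι).hom.hom z
  let x : XS.obj.V := E.hom.hom.hom w
  -- `U := Stab_{π₁^temp(𝒢)}(x)`, open with `1 ∈ U`; claim `φ⁻¹(U) ⊆ N′`
  refine ⟨{g : c.G | XS.obj.ρ g x = x}, XS.property.2 x, ?_, fun g' hg' => ?_⟩
  · show XS.obj.ρ 1 x = x
    rw [map_one]
    rfl
  · have hx : XS.obj.ρ (φ g') x = x := hg'
    -- (a) `w` is fixed by `g′` (`E` is equivariant and injective)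
    have hEinj : Function.Injective (E.hom.hom.hom : _ → _) := BTemp.iso_injective E
    have hw : (c'.equiv.functor.obj SH).obj.ρ g' w = w := by
      apply hEinj
      have hcomm := ConcreteCategory.congr_hom (E.hom.hom.comm g') w
      simp only [types_comp_apply] at hcomm
      rw [hcomm]
      exact hx
    -- (b) `c′(ι)` is injective on carriers (fibrewise injectivity of `ι` at `v`, through `Jnat`) and
    -- equivariant, so `z` is fixed by `g′`
    have hJsurj : Function.Surjective ((Jnat.hom.app C).hom.hom : _ → _) :=
      BTemp.iso_surjective (Jnat.app C)
    have hJinj : Function.Injective ((Jnat.hom.app SH).hom.hom : _ → _) :=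
      BTemp.iso_injective (Jnat.app SH)
    have hnat : ∀ y : (C.obj.SV v).obj.V,
        (c'.equiv.functor.map ι).hom.hom ((Jnat.hom.app C).hom.hom y) =
          (Jnat.hom.app SH).hom.hom ((ι.hom.fV v).hom.hom y) := by
      intro y
      have hn := Jnat.hom.naturality ι
      apply_fun (fun g => g.hom.hom) at hn
      have hn' :
          (Jnat.hom.app SH).hom.hom ((ι.hom.fV v).hom.hom y) =
            (c'.equiv.functor.map ι).hom.hom ((Jnat.hom.app C).hom.hom y) :=
        ConcreteCategory.congr_hom hn y
      exact hn'.symm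
    have hιinj : Function.Injective ((c'.equiv.functor.map ι).hom.hom : _ → _) := by
      intro a b hab
      obtain ⟨a', rfl⟩ := hJsurj a
      obtain ⟨b', rfl⟩ := hJsurj b
      rw [hnat, hnat] at hab
      rw [hι (hJinj hab)]
    have hz : (c'.equiv.functor.obj C).obj.ρ g' z = z := by
      apply hιinj
      have hcomm := ConcreteCategory.congr_hom ((c'.equiv.functor.map ι).hom.comm g') z
      simp only [types_comp_apply] at hcomm
      rw [hcomm]
      exact hw
    -- (c) push `z` forward to `c′(T) ≅ Π′/N′`
    let y : (c'.equiv.functor.obj T).obj.V := (c'.equiv.functor.map f).hom.hom z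
    have hy : (c'.equiv.functor.obj T).obj.ρ g' y = y := by
      have hcomm := ConcreteCategory.congr_hom ((c'.equiv.functor.map f).hom.comm g') z
      simp only [types_comp_apply] at hcomm
      show (c'.equiv.functor.obj T).obj.ρ g' ((c'.equiv.functor.map f).hom.hom z) = _
      rw [← hcomm, hz]
    let q : Q.obj.V := (c'.equiv.counitIso.hom.app Q).hom.hom y
    have hq : Q.obj.ρ g' q = q := by
      have hcomm :
          (c'.equiv.counitIso.hom.app Q).hom.hom ((c'.equiv.functor.obj T).obj.ρ g' y) =
            Q.obj.ρ g' q :=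
        ConcreteCategory.congr_hom ((c'.equiv.counitIso.hom.app Q).hom.comm g') y
      rw [hy] at hcomm
      exact hcomm.symm
    -- (d) a point of `Π′/N′` fixed by `g′` forces `g′ ∈ N′`
    exact mem_of_smul_quotient_eq N'.toSubgroup g' q hq

/-- **… hence a CLOSED EMBEDDING** (injective, inducing, closed range — the engines of
`TemperedDecompositionCommTerminal.lean`). [cite: Mochizuki2012, IUTchI §2 p.44] -/
theorem IsDecompHom.isClosedEmbedding_of_dom (h37H : (𝒢.restrict H).Thm37Hypotheses)
    {c' : TemperedPiChart (𝒢.restrict H)} {φ : c'.G →ₜ* c.G} (hφ : c.IsDecompHom H c' φ)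
    (hdom : ∀ (T : BTempCat (𝒢.restrict H)) (v : H.toSemiGraph.Vertex) (t : (T.obj.SV v).obj.V),
      ∃ (S : BTempCat 𝒢) (C : BTempCat (𝒢.restrict H)) (ι : C ⟶ (𝒢.btempRestrict H).obj S)
        (f : C ⟶ T) (s : (C.obj.SV v).obj.V),
        Function.Injective (ι.hom.fV v).hom.hom ∧ (f.hom.fV v).hom.hom s = t) :
    IsClosedEmbedding φ :=
  haveI := c.isTopologicalGroup
  have hind := hφ.isInducing_of_dom h37H hdom
  ⟨⟨hind, c'.isTempered.injective_of_isInducing φ hind⟩,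
    c.isTempered.isClosed_range_of_isInducing c'.isTempered φ hind⟩

/-- **(P2) modulo (DOM)**: [IUTchI] Prop. 2.2, third inclusion — every decomposition subgroup of `ℍ` is
commensurably terminal in `π₁^temp(𝒢)` — from Thm. 3.7's hypotheses for `𝒢` and `𝒢_ℍ`, Thm. 3.7 (iii)
at `𝒢_ℍ`, one decomposition homomorphism, and the pointed domination property (DOM)
(`decompSubgroupsCommensurablyTerminal_of_isInducing` ∘ `IsDecompHom.isInducing_of_dom`).
[cite: Mochizuki2012, IUTchI Prop 2.2 p.45] -/
theorem decompSubgroupsCommensurablyTerminal_of_dom (h37 : 𝒢.Thm37Hypotheses)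
    (h37H : (𝒢.restrict H).Thm37Hypotheses) (hCIV : CompactInVerticialAt (𝒢.restrict H))
    {c' : TemperedPiChart (𝒢.restrict H)} {φ : c'.G →ₜ* c.G} (hφ : c.IsDecompHom H c' φ)
    (hdom : ∀ (T : BTempCat (𝒢.restrict H)) (v : H.toSemiGraph.Vertex) (t : (T.obj.SV v).obj.V),
      ∃ (S : BTempCat 𝒢) (C : BTempCat (𝒢.restrict H)) (ι : C ⟶ (𝒢.btempRestrict H).obj S)
        (f : C ⟶ T) (s : (C.obj.SV v).obj.V),
        Function.Injective (ι.hom.fV v).hom.hom ∧ (f.hom.fV v).hom.hom s = t) :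
    c.DecompSubgroupsCommensurablyTerminal H :=
  decompSubgroupsCommensurablyTerminal_of_isInducing h37 h37H hCIV hφ (hφ.isInducing_of_dom h37H hdom)

/-- **(P2) modulo (DOM), finite `ℍ`** (Thm. 3.7 (iii) at `𝒢_ℍ` := `compactInVerticialFin_holds`).
[cite: Mochizuki2012, IUTchI Prop 2.2 p.45] -/
theorem decompSubgroupsCommensurablyTerminal_of_dom_of_finite [hV : Finite H.toSemiGraph.Vertex]
    [hE : Finite H.toSemiGraph.Edge] (h37 : 𝒢.Thm37Hypotheses) (h37H : (𝒢.restrict H).Thm37Hypotheses)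
    {c' : TemperedPiChart (𝒢.restrict H)} {φ : c'.G →ₜ* c.G} (hφ : c.IsDecompHom H c' φ)
    (hdom : ∀ (T : BTempCat (𝒢.restrict H)) (v : H.toSemiGraph.Vertex) (t : (T.obj.SV v).obj.V),
      ∃ (S : BTempCat 𝒢) (C : BTempCat (𝒢.restrict H)) (ι : C ⟶ (𝒢.btempRestrict H).obj S)
        (f : C ⟶ T) (s : (C.obj.SV v).obj.V),
        Function.Injective (ι.hom.fV v).hom.hom ∧ (f.hom.fV v).hom.hom s = t) :
    c.DecompSubgroupsCommensurablyTerminal H :=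
  decompSubgroupsCommensurablyTerminal_of_dom h37 h37H (@compactInVerticialFin_holds (𝒢.restrict H) hV hE)
    hφ hdom

/-- **(P1), tempered part, modulo (DOM)**: the decomposition homomorphism is injective and every
decomposition subgroup of `ℍ` is CLOSED in `π₁^temp(𝒢)` (input `hDcl` of abc-iut's profinite (P1) file).
[cite: Mochizuki2012, IUTchI §2 p.44] -/
theorem isClosed_of_mem_decompSubgroups_of_dom (h37H : (𝒢.restrict H).Thm37Hypotheses)
    {c' : TemperedPiChart (𝒢.restrict H)} {φ : c'.G →ₜ* c.G} (hφ : c.IsDecompHom H c' φ)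
    (hdom : ∀ (T : BTempCat (𝒢.restrict H)) (v : H.toSemiGraph.Vertex) (t : (T.obj.SV v).obj.V),
      ∃ (S : BTempCat 𝒢) (C : BTempCat (𝒢.restrict H)) (ι : C ⟶ (𝒢.btempRestrict H).obj S)
        (f : C ⟶ T) (s : (C.obj.SV v).obj.V),
        Function.Injective (ι.hom.fV v).hom.hom ∧ (f.hom.fV v).hom.hom s = t)
    {D : Subgroup c.G} (hD : D ∈ c.decompSubgroups H) :
    Function.Injective φ ∧ IsClosed (D : Set c.G) :=
  isClosed_of_mem_decompSubgroups_of_isInducing hφ (hφ.isInducing_of_dom h37H hdom) hD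

end TemperedPiChart

end ProfiniteSemiGraph

end Literature.AnabelianGeometry.SemiGraphs
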